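import Summits.QuantumFields.BalabanUV.T4Continuum.Support.VariationalColourLift
import Summits.QuantumFields.BalabanUV.T4Continuum.Support.VariationalColourScalarPair
import Summits.QuantumFields.BalabanUV.T4Continuum.Support.VariationalColourOneStep

/-!
# T⁴ programme, spine node NE2 (U1a), lane P2 — SUPPLIER ITEM (O8) «V-COL-P», PART 1: LEAF P⁺ IN COLOUR, LOCAL — the covariant block
# Poincaré inequality for 0-forms with values in a finite-dimensional Hilbert space `E` under a UNITARY frame whose defect is known on
# IN-BLOCK bonds only; the frames built from the data (`G := T`) and the relative form (`G := T₀`)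
# (the colour re-run of leaf-01-g4's `VariationalCovariantPoincareLocal` §1–§3b (p215015) over leaf-09-g4's `VariationalColourLift` (p215422))

NE2 formalisation swarm `b2b-balaban-t4-ne2-formalise-*`, leaf prover 02 (gen 4); P2 skeleton `t4/skeletons/NE2-t4-ne2-p2.md` v0.10 §2.E row
V-COL, member P⁺ (the last displayed socket of `VariationalColourScalarPair.colour_pair_bracket`, p215316).  Carriers: `VariationalColourFederbush.
{cDv, dirUv, Qcv}` (p214930), leaf-03-g4's `nsqv` (p215022), leaf-09-g4's `mulVecv ∕ mulVecv_sdiff ∕ mulVecv_PiS ∕ norm_sq_sub_PiS_le_inBlock_colour`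
(p215422, the `U = 1` in-block Poincaré inequality in colour — leaf-01-g4's (O6)(a) lifted) and `VariationalColourOneStep.norm_apply_of_mem_unitary`
(p215297, `‖U v‖ = ‖v‖`) BY NAME.
 * §1 STEP (i) localised, in colour: with the frame defect `‖G(x+e_μ) − G(x)∘R(x,μ)‖ ≤ m_G` known ONLY on in-block bonds
   (`blockOf (x+e_μ) = blockOf x`), `Σ_ν Σ_{in-block x} ‖n•(g(x+e_ν) − g x)‖² ≤ 2n²·(Σ_μ dirUv R f μ + d·m_G²·nsqv f)`, `g x := G x (f x)`
   (order-consistent split `G(x′)f(x′) − G(x)f(x) = (G(x′) − G(x)∘R) f(x′) + G(x)(R f(x′) − f x)`);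
 * §2 STEP (ii) in colour: block operators `c z` (`‖c z‖ ≤ 1`) with `‖G(bpt z j) − c z ∘ T(bpt z j)‖ ≤ m_B` ⟹
   `Σ_x ‖(Π′g) x‖² ≤ 2n^d·Σ_z ‖Qcv n M T f z‖² + 2m_B²·nsqv f`;
 * §3 **`nsqv_le_colour_poincare_local : nsqv f ≤ 8·n^d·Σ_z ‖Qcv n M T f z‖² + 4·n²·Σ_μ dirUv (fine n M) R f μ`** under
   `2d·(n·m_G)² + 4·m_B² ≤ ½` — SAME constants as the scalar leaf;
 * §4 THE FRAMES FROM THE DATA: `G := T` unitary, `c := 1`, `m_B := 0`, `m_G := w` where `‖T(x+e_μ) − T(x)∘R(x,μ)‖ = ‖R∘T(x+e_μ)⋆∘T(x) − 1‖`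
   (`norm_transport_frame_eq`; the C⋆-identities `‖U A‖ = ‖A‖ = ‖A U‖` for unitary `U`) = leaf-03-g4's UB⁺-colour in-block defect ⟹
   **`nsqv_le_colour_poincare_of_blockOf`**; and the RELATIVE form **`nsqv_le_colour_poincare_rel`** (`G := T₀`, `m_B := γ` with
   `‖T x − T₀ x‖ ≤ γ`, `= ‖T x ∘ T₀ x⋆ − 1‖` by `norm_rel_eq`) for the owner's repair line N-ne2p2g11-2.
Part 2 (`VariationalColourPoincarePhys`): the physical-units sockets `hPc` ∕ `hPf` of `colour_pair_bracket` (`qWv_le_coarse_local`, `qVv_le_composite_local`, …).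

HONEST FRAMING (T4-DAG p. 1).  Model level (operators DATA; no identification with Bałaban's `U(Γ)` — c5); [folklore] lattice calculus + the
tree's colour lift; nothing printed is a hypothesis; no `def`; no `sorry`; axioms standard.  NE2 NOT proved; spine PROVED 0∕9; rung (B)+1 finite
T⁴ — NOT infinite volume, NOT a mass gap, NOT Clay.  HONEST DEPENDENCY (cell, verbatim): continuum YM on T⁴ ⇐ BetaPertH ∧ nine spine estimates
(0/9 proved); BetaPertH ⇐ (D1) ∧ (D4) ∧ CAP+tail; G-an2-4 gates asym, D1 and NE2/3/4.
-/

noncomputable section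

namespace Summit.QuantumFields.BalabanUV.T4Continuum.VariationalColourPoincareLocal

open Finset
open Literature.MathematicalPhysics.QuantumFieldTheory.Balaban1983to89
open Literature.MathematicalPhysics.QuantumFieldTheory.Balaban1983to89.B5Prop11Plancherel (Tor fine unitVec)
open Literature.MathematicalPhysics.QuantumFieldTheory.Balaban1983to89.B5Action121 (sdiff)
open Literature.MathematicalPhysics.QuantumFieldTheory.Balaban1983to89.B5Block118 (bpt)
open Literature.MathematicalPhysics.QuantumFieldTheory.Balaban1983to89.B5Blocks16 (blockOf blockOf_bpt)
open Literature.MathematicalPhysics.QuantumFieldTheory.Balaban1983to89.B5AverageCurlStokes (sum_blocks_real)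
open Summit.QuantumFields.BalabanUV.T4Continuum.ScalarBlockPoincare (PiS)
open Summit.QuantumFields.BalabanUV.T4Continuum.VariationalCovariantFederbush (sq_sum_le_card_mul)
open Summit.QuantumFields.BalabanUV.T4Continuum.VariationalColourFederbush (cDv dirUv Qcv dirUv_nonneg norm_le_one_of_mem_unitary)
open Summit.QuantumFields.BalabanUV.T4Continuum.VariationalColourUpperBound (nsqv nsqv_nonneg)
open Summit.QuantumFields.BalabanUV.T4Continuum.VariationalColourLift (mulVecv mulVecv_sdiff mulVecv_PiS norm_sq_sub_PiS_le_inBlock_colour)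
open Summit.QuantumFields.BalabanUV.T4Continuum.VariationalColourOneStep (norm_apply_of_mem_unitary)

variable {d : ℕ} {E : Type*} [NormedAddCommGroup E] [InnerProductSpace ℂ E] [CompleteSpace E]
variable (n : ℕ) [NeZero n] (M : Fin d → ℕ) [hM : ∀ μ, NeZero (M μ)]

/-! ## §1 STEP (i) localised, in colour: the in-block differences of the framed field -/

/-- `nsqv (G·f) = nsqv f` for a unitary frame. [folklore] -/
theorem nsqv_frame {G : Tor (fine n M) → (E →L[ℂ] E)} (hG : ∀ x, G x ∈ unitary (E →L[ℂ] E)) (f : Tor (fine n M) → E) :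
    nsqv (fun x => G x (f x)) = nsqv f := by
  unfold nsqv
  exact sum_congr rfl fun x _ => by rw [norm_apply_of_mem_unitary (hG x)]

omit [NeZero n] hM in
/-- pointwise, at ONE bond where the frame defect is known: `‖g(x+e) − g(x)‖² ≤ 2·m_G²‖f(x+e)‖² + 2·‖R(x,ν)f(x+e) − f(x)‖²` (`g = G·f`, `G` unitary;
order-consistent split `G(x′)f(x′) − G(x)f(x) = (G(x′) − G(x)∘R) f(x′) + G(x)(R f(x′) − f x)`). [folklore] -/
theorem norm_frame_diff_sq_le {R : Tor (fine n M) → Fin d → (E →L[ℂ] E)} {G : Tor (fine n M) → (E →L[ℂ] E)}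
    (hG : ∀ x, G x ∈ unitary (E →L[ℂ] E)) {mG : ℝ} (f : Tor (fine n M) → E) {x : Tor (fine n M)} {ν : Fin d}
    (hx : ‖G (x + unitVec (fine n M) ν) - G x * R x ν‖ ≤ mG) :
    ‖G (x + unitVec (fine n M) ν) (f (x + unitVec (fine n M) ν)) - G x (f x)‖ ^ 2
      ≤ 2 * (mG ^ 2 * ‖f (x + unitVec (fine n M) ν)‖ ^ 2) + 2 * ‖cDv (fine n M) R f x ν‖ ^ 2 := by
  have e : G (x + unitVec (fine n M) ν) (f (x + unitVec (fine n M) ν)) - G x (f x)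
      = (G (x + unitVec (fine n M) ν) - G x * R x ν) (f (x + unitVec (fine n M) ν)) + G x (cDv (fine n M) R f x ν) := by
    simp only [cDv, sub_apply, mul_apply_eq_comp, map_sub]
    abel
  have h1 : ‖G (x + unitVec (fine n M) ν) (f (x + unitVec (fine n M) ν)) - G x (f x)‖
      ≤ mG * ‖f (x + unitVec (fine n M) ν)‖ + ‖cDv (fine n M) R f x ν‖ := by
    rw [e]
    refine (norm_add_le _ _).trans (add_le_add ?_ (le_of_eq (norm_apply_of_mem_unitary (hG x) _)))
    exact (ContinuousLinearMap.le_opNorm _ _).trans (mul_le_mul_of_nonneg_right hx (norm_nonneg _))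
  have h2 := pow_le_pow_left₀ (norm_nonneg _) h1 2
  refine h2.trans ?_
  rw [← mul_pow]
  nlinarith [sq_nonneg (mG * ‖f (x + unitVec (fine n M) ν)‖ - ‖cDv (fine n M) R f x ν‖)]

/-- **STEP (i) LOCALISED, IN COLOUR**: with the frame defect known ONLY on the in-block bonds (`blockOf (x + e_μ) = blockOf x`), the in-block plain
Dirichlet sum of `g = G·f` obeys `Σ_ν Σ_{in-block x} ‖(∂_ν g)(x)‖² ≤ 2n²·(Σ_μ dirUv R f μ + d·m_G²·nsqv f)` (`∂_ν = n(S_ν − 1)` componentwise). [folklore] -/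
theorem sum_inBlock_norm_sq_sdiff_frame_le {R : Tor (fine n M) → Fin d → (E →L[ℂ] E)} {G : Tor (fine n M) → (E →L[ℂ] E)}
    (hG : ∀ x, G x ∈ unitary (E →L[ℂ] E)) {mG : ℝ}
    (hframe : ∀ (x : Tor (fine n M)) (μ : Fin d), blockOf n M (x + unitVec (fine n M) μ) = blockOf n M x →
      ‖G (x + unitVec (fine n M) μ) - G x * R x μ‖ ≤ mG)
    (f : Tor (fine n M) → E) :
    ∑ ν : Fin d, ∑ x ∈ univ.filter (fun x : Tor (fine n M) => blockOf n M (x + unitVec (fine n M) ν) = blockOf n M x),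
        ‖mulVecv (sdiff (fine n M) (n : ℂ) ν) (fun x => G x (f x)) x‖ ^ 2
      ≤ 2 * (n : ℝ) ^ 2 * (∑ μ, dirUv (fine n M) R f μ + d * mG ^ 2 * nsqv f) := by
  have per : ∀ ν : Fin d, ∑ x ∈ univ.filter (fun x : Tor (fine n M) => blockOf n M (x + unitVec (fine n M) ν) = blockOf n M x),
        ‖mulVecv (sdiff (fine n M) (n : ℂ) ν) (fun x => G x (f x)) x‖ ^ 2
      ≤ (n : ℝ) ^ 2 * (2 * (mG ^ 2 * nsqv f) + 2 * dirUv (fine n M) R f ν) := by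
    intro ν
    set maj : Tor (fine n M) → ℝ := fun x => (n : ℝ) ^ 2 * (2 * (mG ^ 2 * ‖f (x + unitVec (fine n M) ν)‖ ^ 2)
      + 2 * ‖cDv (fine n M) R f x ν‖ ^ 2) with hmaj
    have hmaj0 : ∀ x, 0 ≤ maj x := fun x => by positivity
    have step1 : ∑ x ∈ univ.filter (fun x : Tor (fine n M) => blockOf n M (x + unitVec (fine n M) ν) = blockOf n M x),
          ‖mulVecv (sdiff (fine n M) (n : ℂ) ν) (fun x => G x (f x)) x‖ ^ 2 ≤ ∑ x, maj x := by
      refine (sum_le_sum fun x hx => ?_).trans (sum_le_sum_of_subset_of_nonneg (filter_subset _ _) fun x _ _ => hmaj0 x)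
      have hx' : blockOf n M (x + unitVec (fine n M) ν) = blockOf n M x := (mem_filter.mp hx).2
      rw [mulVecv_sdiff, norm_smul, mul_pow, Complex.norm_natCast, hmaj]
      exact mul_le_mul_of_nonneg_left (norm_frame_diff_sq_le n M hG f (hframe x ν hx')) (by positivity)
    refine step1.trans (le_of_eq ?_)
    have hshift : ∑ x : Tor (fine n M), ‖f (x + unitVec (fine n M) ν)‖ ^ 2 = nsqv f :=
      Fintype.sum_equiv (Equiv.addRight (unitVec (fine n M) ν)) _ _ fun x => rfl
    simp only [hmaj]
    rw [← mul_sum, sum_add_distrib, ← mul_sum, ← mul_sum, ← mul_sum, hshift]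
    rfl
  refine (sum_le_sum fun ν _ => per ν).trans (le_of_eq ?_)
  rw [← mul_sum, sum_add_distrib, sum_const, Finset.card_univ, Fintype.card_fin, nsmul_eq_mul, ← mul_sum]
  ring

/-! ## §2 STEP (ii) in colour: the block means of the framed field against the transported averages -/

omit [CompleteSpace E] in
/-- **STEP (ii), IN COLOUR**: block operators `c z` (`‖c z‖ ≤ 1`) with `‖G(bpt z j) − c z ∘ T(bpt z j)‖ ≤ m_B` on sites ⟹
`Σ_x ‖(Π′g)(x)‖² ≤ 2n^d·Σ_z ‖Qcv n M T f z‖² + 2m_B²·nsqv f` (`g = G·f`). [folklore] -/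
theorem sum_norm_sq_PiS_frame_le {T G : Tor (fine n M) → (E →L[ℂ] E)} {c : Tor M → (E →L[ℂ] E)} (hc : ∀ z, ‖c z‖ ≤ 1) {mB : ℝ}
    (hblock : ∀ z j, ‖G (bpt n M z j) - c z * T (bpt n M z j)‖ ≤ mB) (f : Tor (fine n M) → E) :
    ∑ x, ‖mulVecv (PiS n M) (fun x => G x (f x)) x‖ ^ 2 ≤ 2 * (n : ℝ) ^ d * ∑ z, ‖Qcv n M T f z‖ ^ 2 + 2 * mB ^ 2 * nsqv f := by
  have hn : (0 : ℝ) < (n : ℝ) ^ d := by have := NeZero.ne n; positivity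
  have hnC : ((n : ℂ) ^ d) ≠ 0 := pow_ne_zero _ (by exact_mod_cast NeZero.ne n)
  have hcard : ((Finset.univ : Finset (Fin d → Fin n)).card : ℝ) = (n : ℝ) ^ d := by
    rw [Finset.card_univ, Fintype.card_fun, Fintype.card_fin, Fintype.card_fin]; push_cast; ring
  -- the block mean at the points of block `z`
  set mean : Tor M → E := fun z => ((1 : ℂ) / (n : ℂ) ^ d) • ∑ j : Fin d → Fin n, G (bpt n M z j) (f (bpt n M z j)) with hmean
  have hPi : ∀ (z : Tor M) (j : Fin d → Fin n), mulVecv (PiS n M) (fun x => G x (f x)) (bpt n M z j) = mean z := by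
    intro z j; rw [mulVecv_PiS, blockOf_bpt]
  -- pointwise: `mean z = c z (Qcv f z) + (n^d)⁻¹ • Σ_j (G − c T)(b_j) f(b_j)`
  have hz : ∀ z : Tor M, ‖mean z‖ ≤ ‖Qcv n M T f z‖ + mB * (((n : ℝ) ^ d)⁻¹ * ∑ j : Fin d → Fin n, ‖f (bpt n M z j)‖) := by
    intro z
    have e : mean z = c z (Qcv n M T f z)
          + ((n : ℂ) ^ d)⁻¹ • ∑ j : Fin d → Fin n, (G (bpt n M z j) - c z * T (bpt n M z j)) (f (bpt n M z j)) := by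
      simp only [hmean, Qcv, one_div, map_smul, map_sum, sub_apply, mul_apply_eq_comp]
      rw [← smul_add, ← sum_add_distrib]
      congr 1
      exact sum_congr rfl fun j _ => by abel
    rw [e]
    refine (norm_add_le _ _).trans (add_le_add ?_ ?_)
    · exact (ContinuousLinearMap.le_opNorm _ _).trans (mul_le_of_le_one_left (norm_nonneg _) (hc z))
    · rw [norm_smul, norm_inv, norm_pow, Complex.norm_natCast, mul_comm mB, mul_assoc]
      refine mul_le_mul_of_nonneg_left ?_ (by positivity)
      rw [sum_mul]
      refine (norm_sum_le _ _).trans (sum_le_sum fun j _ => ?_)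
      calc ‖(G (bpt n M z j) - c z * T (bpt n M z j)) (f (bpt n M z j))‖
          ≤ ‖G (bpt n M z j) - c z * T (bpt n M z j)‖ * ‖f (bpt n M z j)‖ := ContinuousLinearMap.le_opNorm _ _
        _ ≤ mB * ‖f (bpt n M z j)‖ := mul_le_mul_of_nonneg_right (hblock z j) (norm_nonneg _)
        _ = ‖f (bpt n M z j)‖ * mB := mul_comm _ _
  have hz2 : ∀ z : Tor M, (n : ℝ) ^ d * ‖mean z‖ ^ 2
      ≤ 2 * (n : ℝ) ^ d * ‖Qcv n M T f z‖ ^ 2 + 2 * mB ^ 2 * ∑ j : Fin d → Fin n, ‖f (bpt n M z j)‖ ^ 2 := by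
    intro z
    have h1 := pow_le_pow_left₀ (norm_nonneg _) (hz z) 2
    have h2 : (‖Qcv n M T f z‖ + mB * (((n : ℝ) ^ d)⁻¹ * ∑ j : Fin d → Fin n, ‖f (bpt n M z j)‖)) ^ 2
        ≤ 2 * ‖Qcv n M T f z‖ ^ 2 + 2 * (mB * (((n : ℝ) ^ d)⁻¹ * ∑ j : Fin d → Fin n, ‖f (bpt n M z j)‖)) ^ 2 := by
      nlinarith [sq_nonneg (‖Qcv n M T f z‖ - mB * (((n : ℝ) ^ d)⁻¹ * ∑ j : Fin d → Fin n, ‖f (bpt n M z j)‖))]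
    have hcs : (∑ j : Fin d → Fin n, ‖f (bpt n M z j)‖) ^ 2 ≤ (n : ℝ) ^ d * ∑ j : Fin d → Fin n, ‖f (bpt n M z j)‖ ^ 2 := by
      have h := sq_sum_le_card_mul (Finset.univ : Finset (Fin d → Fin n)) (fun j => ‖f (bpt n M z j)‖)
      rwa [hcard] at h
    have h3 : (n : ℝ) ^ d * (mB * (((n : ℝ) ^ d)⁻¹ * ∑ j : Fin d → Fin n, ‖f (bpt n M z j)‖)) ^ 2
        ≤ mB ^ 2 * ∑ j : Fin d → Fin n, ‖f (bpt n M z j)‖ ^ 2 := by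
      rw [mul_pow, mul_pow, inv_pow]
      calc (n : ℝ) ^ d * (mB ^ 2 * ((((n : ℝ) ^ d) ^ 2)⁻¹ * (∑ j : Fin d → Fin n, ‖f (bpt n M z j)‖) ^ 2))
          ≤ (n : ℝ) ^ d * (mB ^ 2 * ((((n : ℝ) ^ d) ^ 2)⁻¹ * ((n : ℝ) ^ d * ∑ j : Fin d → Fin n, ‖f (bpt n M z j)‖ ^ 2))) := by
            gcongr
        _ = mB ^ 2 * ∑ j : Fin d → Fin n, ‖f (bpt n M z j)‖ ^ 2 := by field_simp
    nlinarith [mul_le_mul_of_nonneg_left h1 hn.le, mul_le_mul_of_nonneg_left h2 hn.le]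
  -- sum over the blocks
  rw [sum_blocks_real n M (fun x => ‖mulVecv (PiS n M) (fun x => G x (f x)) x‖ ^ 2)]
  simp_rw [hPi]
  have hconst : ∀ z : Tor M, ∑ _j : Fin d → Fin n, ‖mean z‖ ^ 2 = (n : ℝ) ^ d * ‖mean z‖ ^ 2 := fun z => by
    rw [sum_const, nsmul_eq_mul, hcard]
  rw [sum_congr rfl fun z _ => hconst z]
  refine (sum_le_sum fun z _ => hz2 z).trans (le_of_eq ?_)
  rw [sum_add_distrib, ← mul_sum, ← mul_sum, ← sum_blocks_real n M (fun x => ‖f x‖ ^ 2)]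
  rfl

/-! ## §3 Leaf P⁺ in colour with the frame hypothesis on in-block bonds only -/

/-- **LEAF P⁺ IN COLOUR, LOCALISED (lattice units)**: `nsqv f ≤ 8·n^d·Σ_z ‖(Q_T f)(z)‖² + 4·n²·Σ_μ dirUv (fine n M) R f μ` for a UNITARY frame `G`
whose bond defect `m_G` is controlled on the IN-BLOCK bonds only, block operators `c` (`‖c‖ ≤ 1`) with `‖G − c∘T‖ ≤ m_B` on sites, and the PER-BLOCK
smallness `2d·(n·m_G)² + 4·m_B² ≤ ½`. [folklore] -/
theorem nsqv_le_colour_poincare_local [FiniteDimensional ℂ E] {R : Tor (fine n M) → Fin d → (E →L[ℂ] E)}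
    {T G : Tor (fine n M) → (E →L[ℂ] E)} {c : Tor M → (E →L[ℂ] E)} (hG : ∀ x, G x ∈ unitary (E →L[ℂ] E)) (hc : ∀ z, ‖c z‖ ≤ 1) {mG mB : ℝ}
    (hframe : ∀ (x : Tor (fine n M)) (μ : Fin d), blockOf n M (x + unitVec (fine n M) μ) = blockOf n M x →
      ‖G (x + unitVec (fine n M) μ) - G x * R x μ‖ ≤ mG)
    (hblock : ∀ z j, ‖G (bpt n M z j) - c z * T (bpt n M z j)‖ ≤ mB)
    (hsmall : 2 * (d : ℝ) * ((n : ℝ) * mG) ^ 2 + 4 * mB ^ 2 ≤ 1 / 2) (f : Tor (fine n M) → E) :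
    nsqv f ≤ 8 * (n : ℝ) ^ d * ∑ z, ‖Qcv n M T f z‖ ^ 2 + 4 * (n : ℝ) ^ 2 * ∑ μ, dirUv (fine n M) R f μ := by
  set g : Tor (fine n M) → E := fun x => G x (f x) with hg
  have hgf : nsqv g = nsqv f := nsqv_frame n M hG f
  -- `‖g‖² ≤ 2‖g − Πg‖² + 2‖Πg‖²` pointwise, summed
  have hsplit : nsqv g ≤ 2 * ∑ x, ‖g x - mulVecv (PiS n M) g x‖ ^ 2 + 2 * ∑ x, ‖mulVecv (PiS n M) g x‖ ^ 2 := by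
    unfold nsqv
    rw [mul_sum, mul_sum, ← sum_add_distrib]
    refine sum_le_sum fun x _ => ?_
    have h : ‖g x‖ ≤ ‖g x - mulVecv (PiS n M) g x‖ + ‖mulVecv (PiS n M) g x‖ := by
      have := norm_add_le (g x - mulVecv (PiS n M) g x) (mulVecv (PiS n M) g x)
      rwa [sub_add_cancel] at this
    nlinarith [h, norm_nonneg (g x), sq_nonneg (‖g x - mulVecv (PiS n M) g x‖ - ‖mulVecv (PiS n M) g x‖)]
  have hP := norm_sq_sub_PiS_le_inBlock_colour n M g
  have h1 := sum_inBlock_norm_sq_sdiff_frame_le n M hG hframe f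
  have h2 := sum_norm_sq_PiS_frame_le n M (G := G) hc hblock f
  have hD : 0 ≤ ∑ μ, dirUv (fine n M) R f μ := sum_nonneg fun _ _ => dirUv_nonneg _ _ _ _
  have hQ : 0 ≤ ∑ z, ‖Qcv n M T f z‖ ^ 2 := sum_nonneg fun _ _ => by positivity
  rw [← hg] at h1 h2
  rw [← hgf] at h1 h2 ⊢
  set S := ∑ ν : Fin d, ∑ x ∈ univ.filter (fun x : Tor (fine n M) => blockOf n M (x + unitVec (fine n M) ν) = blockOf n M x),
      ‖mulVecv (sdiff (fine n M) (n : ℂ) ν) g x‖ ^ 2 with hS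
  set D := ∑ μ, dirUv (fine n M) R f μ with hDdef
  set Q := ∑ z, ‖Qcv n M T f z‖ ^ 2 with hQdef
  have hg0 : 0 ≤ nsqv g := nsqv_nonneg g
  have s1 : nsqv g ≤ 2 * (1 / 2 * S) + 2 * (2 * (n : ℝ) ^ d * Q + 2 * mB ^ 2 * nsqv g) :=
    hsplit.trans (add_le_add (mul_le_mul_of_nonneg_left hP (by norm_num)) (mul_le_mul_of_nonneg_left h2 (by norm_num)))
  have key : nsqv g ≤ 2 * (n : ℝ) ^ 2 * D + 4 * (n : ℝ) ^ d * Q + (2 * (d : ℝ) * ((n : ℝ) * mG) ^ 2 + 4 * mB ^ 2) * nsqv g := by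
    have e : (2 * (d : ℝ) * ((n : ℝ) * mG) ^ 2 + 4 * mB ^ 2) * nsqv g = 2 * (n : ℝ) ^ 2 * (d * mG ^ 2 * nsqv g) + 4 * mB ^ 2 * nsqv g := by
      ring
    rw [e]
    nlinarith [s1, h1]
  nlinarith [key, mul_le_mul_of_nonneg_right hsmall hg0]

/-! ## §4 The frames are constructible from the data — no frame, no global small field; and the relative form -/

omit [NeZero n] hM in
/-- for a UNITARY site operator the frame defect of `G := T` IS the UB⁺-colour in-block transport defect:
`‖T(x′) − T(x)∘R‖ = ‖R∘T(x′)⋆∘T(x) − 1‖` (`‖U A‖ = ‖A‖ = ‖A U‖` for unitary `U`). [folklore] -/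
theorem norm_transport_frame_eq {T : Tor (fine n M) → (E →L[ℂ] E)} (hT : ∀ x, T x ∈ unitary (E →L[ℂ] E)) (R : E →L[ℂ] E)
    (x x' : Tor (fine n M)) : ‖T x' - T x * R‖ = ‖R * star (T x') * T x - 1‖ := by
  obtain ⟨hx1, hx2⟩ := Unitary.mem_iff.mp (hT x)
  obtain ⟨hx1', hx2'⟩ := Unitary.mem_iff.mp (hT x')
  have hA : ∀ Z : E →L[ℂ] E, T x' * (star (T x') * Z) = Z := fun Z => by rw [← mul_assoc, hx2', one_mul]
  have hB : ∀ Z : E →L[ℂ] E, star (T x) * (T x * Z) = Z := fun Z => by rw [← mul_assoc, hx1, one_mul]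
  have e : R * star (T x') * T x - 1 = -(star (T x) * (T x' - T x * R) * (star (T x') * T x)) := by
    simp only [mul_sub, sub_mul, mul_assoc, hA, hB, hx1]
    abel
  have hs : star (T x) ∈ unitary (E →L[ℂ] E) := Unitary.star_mem (hT x)
  have hp : star (T x') * T x ∈ unitary (E →L[ℂ] E) := mul_mem (Unitary.star_mem (hT x')) (hT x)
  rw [e, norm_neg, CStarRing.norm_mul_mem_unitary _ hp, CStarRing.norm_mem_unitary_mul _ hs]

/-- **LEAF P⁺ IN COLOUR WITHOUT FRAMES**: for UNITARY site operators `T` and bond operators `R` whose IN-BLOCK transport defect is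
`‖R(x,μ)∘T(x+e_μ)⋆∘T(x) − 1‖ ≤ w` on every bond with both ends in one block (leaf-03-g4's V-COL-UB binder), and `2d·(n·w)² ≤ ½`:
`nsqv f ≤ 8·n^d·Σ_z ‖(Q_T f)(z)‖² + 4·n²·Σ_μ dirUv R f μ`.  Frame `G := T`, `c := 1`, `m_B := 0`. [folklore] -/
theorem nsqv_le_colour_poincare_of_blockOf [FiniteDimensional ℂ E] {R : Tor (fine n M) → Fin d → (E →L[ℂ] E)}
    {T : Tor (fine n M) → (E →L[ℂ] E)} (hT : ∀ x, T x ∈ unitary (E →L[ℂ] E)) {w : ℝ}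
    (hw' : ∀ (x : Tor (fine n M)) (μ : Fin d), blockOf n M (x + unitVec (fine n M) μ) = blockOf n M x →
      ‖R x μ * star (T (x + unitVec (fine n M) μ)) * T x - 1‖ ≤ w)
    (hsmall : 2 * (d : ℝ) * ((n : ℝ) * w) ^ 2 ≤ 1 / 2) (f : Tor (fine n M) → E) :
    nsqv f ≤ 8 * (n : ℝ) ^ d * ∑ z, ‖Qcv n M T f z‖ ^ 2 + 4 * (n : ℝ) ^ 2 * ∑ μ, dirUv (fine n M) R f μ := by
  refine nsqv_le_colour_poincare_local n M (G := T) (c := fun _ => 1) (mG := w) (mB := 0) hT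
    (fun _ => ContinuousLinearMap.norm_id_le) (fun x μ h => ?_) (fun z j => by rw [one_mul, sub_self, norm_zero]) (by simpa using hsmall) f
  rw [norm_transport_frame_eq n M hT]
  exact hw' x μ h

omit [NeZero n] hM in
/-- for UNITARY `T₀`: `‖T₀ x − 1∘T x‖ = ‖T x ∘ T₀ x⋆ − 1‖` (the relative operator). [folklore] -/
theorem norm_rel_eq {T T₀ : Tor (fine n M) → (E →L[ℂ] E)} (hT₀ : ∀ x, T₀ x ∈ unitary (E →L[ℂ] E)) (x : Tor (fine n M)) :
    ‖T₀ x - 1 * T x‖ = ‖T x * star (T₀ x) - 1‖ := by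
  obtain ⟨h1, h2⟩ := Unitary.mem_iff.mp (hT₀ x)
  have e : T x * star (T₀ x) - 1 = -((T₀ x - 1 * T x) * star (T₀ x)) := by
    rw [one_mul, sub_mul, h2]; abel
  rw [e, norm_neg, CStarRing.norm_mul_mem_unitary _ (Unitary.star_mem (hT₀ x))]

/-- **LEAF P⁺ IN COLOUR RELATIVE TO A REFERENCE TRANSPORT** (the owner's repair line N-ne2p2g11-2): the averaging uses ANY site operators `T`,
the coercivity is read through UNITARY reference operators `T₀` with SMALL in-block defect `‖R(x,μ)∘T₀(x+e_μ)⋆∘T₀(x) − 1‖ ≤ w₀` on in-block bonds and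
relative operator `‖T x ∘ T₀ x⋆ − 1‖ ≤ γ`: `nsqv f ≤ 8·n^d·Σ_z ‖(Q_T f)(z)‖² + 4·n²·Σ_μ dirUv R f μ` provided `2d·(n·w₀)² + 4γ² ≤ ½`. [folklore] -/
theorem nsqv_le_colour_poincare_rel [FiniteDimensional ℂ E] {R : Tor (fine n M) → Fin d → (E →L[ℂ] E)}
    {T T₀ : Tor (fine n M) → (E →L[ℂ] E)} (hT₀ : ∀ x, T₀ x ∈ unitary (E →L[ℂ] E)) {w₀ γ : ℝ}
    (hw₀ : ∀ (x : Tor (fine n M)) (μ : Fin d), blockOf n M (x + unitVec (fine n M) μ) = blockOf n M x →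
      ‖R x μ * star (T₀ (x + unitVec (fine n M) μ)) * T₀ x - 1‖ ≤ w₀)
    (hrel : ∀ x, ‖T x * star (T₀ x) - 1‖ ≤ γ)
    (hsmall : 2 * (d : ℝ) * ((n : ℝ) * w₀) ^ 2 + 4 * γ ^ 2 ≤ 1 / 2) (f : Tor (fine n M) → E) :
    nsqv f ≤ 8 * (n : ℝ) ^ d * ∑ z, ‖Qcv n M T f z‖ ^ 2 + 4 * (n : ℝ) ^ 2 * ∑ μ, dirUv (fine n M) R f μ := by
  refine nsqv_le_colour_poincare_local n M (G := T₀) (c := fun _ => 1) (mG := w₀) (mB := γ) hT₀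
    (fun _ => ContinuousLinearMap.norm_id_le) (fun x μ h => ?_) (fun z j => ?_) hsmall f
  · rw [norm_transport_frame_eq n M hT₀]
    exact hw₀ x μ h
  · rw [norm_rel_eq n M hT₀]
    exact hrel _

end Summit.QuantumFields.BalabanUV.T4Continuum.VariationalColourPoincareLocal

end
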